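import Literature.MathematicalPhysics.QuantumFieldTheory.Balaban1983to89.B14Claim246
import Literature.MathematicalPhysics.QuantumFieldTheory.Balaban1983to89.B8Lemma1NonAbelian

/-!
# `Balaban1983to89.B10Eq13RegularityClaims` — T. Bałaban, *Ultraviolet stability of three-dimensional lattice pure
# gauge field theories*, Commun. Math. Phys. **102** (1985) 255–275 [Balaban1985UV3]: the three in-text regularity
# sentences of Sect. A obtained "by Proposition 1 from [4]" (p. 258, around (12)) and "by Lemma 1 [6] with α₁ = 0"
# (p. 259, before (13); p. 268, around (49)), PROVED for the concrete block average (42) of [4] and the concrete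
# block-pair model of Lemma 1 of [6] on `ℤ^d` (tree: `B7Prop1Local.prop1_local` via `B14.Claim246`,
# `B8Lemma1NonAbelian.lemma1_printedBound` / `lemma1_unitary`) — theorems only

statement-level skeleton of published theorems with citation tags; proofs where landed; nothing here is a claim
about the Yang–Mills mass gap

PDF held: `paper:balaban1985-cmp102-uv-stability-3d` (journal page = PDF page + 254); pp. 258, 259, 268 (PDF 4, 5,
14) read from the held text, p. 259 also from the x2 render
`pub-balaban/b2b-balaban-ref1/pages/1985-cmp102-uv-stability-3d/1985-cmp102-uv-stability-3d-p005-x2.png` (read as an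
image: the two sentences before (13) and the display (13) with `χ₁`, `χ′`).  "[4]" = T. Bałaban, *Averaging operations
for lattice gauge theories*, CMP **98** (1985) [Balaban1985Averaging] (B7), Proposition 1 (51) p. 26 — PROVED in the
tree for the concrete average (42) on `ℤ^d` with the printed locality (`B7Prop1Local.prop1_local`; the `2L²`-form of
the conclusion is r11's `B14.Claim246.Claim246Printed_holds`).  "[6]" = *Spaces of regular gauge field configurations
on a lattice and gauge fixing conditions*, CMP **99** (1985) [Balaban1985RegularSpaces] (B8), Lemma 1 (1.24)–(1.25)
p. 79 — PROVED in the tree for the concrete block-pair model on `ℤ^d` (`B8Lemma1NonAbelian.lemma1_printedBound`,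
`lemma1_unitary`: `|V′_b − 1| < 4d²α₀ + α₁`).  "[7]" = *The variational problem …*, CMP **102** (1985)
[Balaban1985Variational] (B11), Theorem 1 — a statement row (`B11.Thm1Printed`); its output "U₁ satisfies
|U₁(∂p) − 1| < 2B₃g₀p(g₀)" stays a HYPOTHESIS below, exactly as the sentence uses it.

WHAT IS REPRODUCED.  SKELETON rows `B10.Eq12` (p. 258 sentence), `B10.Eq13` (p. 259 sentence; the `χ′` of (13)) and
`B10.Eq49` (p. 268 sentence) of reader r07's `ROWS-B10.md`, where the two mechanisms are recorded as the abstract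
edges `B10.edge_B7Prop1_twoLsq` ([4] Prop. 1 ⇒ "2L²") and `B10.edge_B8Lemma1_alpha1_zero` ([6] Lemma 1 at α₁ = 0)
over the quoted leaves `B7.Prop1Printed`, `B8.Lemma1Printed`.  This file gives the CONCRETE companions: the same
sentences for actual configurations on `ℤ^d`, from the tree's kernel proofs of Prop. 1 of [4] and Lemma 1 of [6].
Mega-formalization `lit-balaban`, HOME `run/shared/lean/pub/lit-balaban/`, Phase-2 proof seat `p29` gen 2, unit
`lit-balaban-p29` (third file of the seat's sweep of in-text claims by [4] Props. 1–2 / [6] Lemma 1: `B14.Claim264`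
(CMP 119 p. 264), `B12Prop2Claims260` (CMP 109 pp. 260, 265), this one).

THE PRINTED TEXT.  p. 258 (verbatim): *"If a configuration U belongs to this region, then it satisfies the
regularity conditions |U(∂p) − 1| < g₀p(g₀) on the domain Ω₀, and by Proposition 1 from [4] the configuration V = Ū
satisfies the conditions |V(∂p′) − 1| < 2L²g₀p(g₀) on Ω₀^{(1)}."*  p. 259 (verbatim, render p005): *"The configuration
U₁ satisfies the regularity conditions |U₁(∂p) − 1| < 2B₃g₀p(g₀) on Ω₁, hence U₁, U′U₁ satisfy the assumptions of
Lemma 1 [6] with α₀ = 2L²B₃g₀p(g₀), α₁ = 0, and the lemma yields the bound |V′ − 1| < 8·3²L²B₃g₀p(g₀) for g₀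
sufficiently small. We enlarge the region of integration to all configurations V′ = e^{iA′} satisfying
|A′| < 16·3²L²B₃g₀p(g₀) on Ω₁."* (in (13): `χ₁ = Π_{p′∈Ω₁^{(1)}} χ({|V(∂p′) − 1| < 2L²g₀p(g₀)})`,
`χ′ = Π_{b∈Ω₁} χ({|A′(b)| < 16·3²L²B₃g₀p(g₀)})`, *"and where we have put U′ = 1, U₁ = V₀ on Ω₁ᶜ"*; (14):
`(U′U₁)‾(Ū₁)⁻¹ = Ũ′`, i.e. the `δ` of (13) equates the averages — the `α₁ = 0`.)  p. 268 (verbatim): *"We introduce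
the gauge fixing terms δ_{Ax(B(Λ_{k+1}))}(V_k) using (9), and we make the translation V_k = V′_kV^{(k)}. The
restrictions on V_k and V^{(k)} imply that the configuration V′_k − 1 is small, more exactly
|V′_k − 1| < 16·3²L²B₃g_kp(g_k)."*  Here `d = 3` ("three-dimensional"): `8·3² = 8d²`, `16·3² = 16d²`.

THE ARGUMENTS FORMALISED.  (a) p. 258: Prop. 1 (51) of [4] at `α₀ = ε₀ := g₀p(g₀)`: `|V̄(∂p′) − 1| < L²ε₀ +
C₀(L²ε₀)² < 2L²ε₀` for `C₀L²ε₀ < 1` — literally the statement `B14.Claim246.Claim246Printed` (CMP 119 p. 246 quotes the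
same sentence at `ε₀ = g₀p₀(g₀)`), so the B10 sentence is RECORDED as that statement, for every `d` (`claim258`), and
unfolded at a plaquette (`claim258_plaq`).  (b) p. 259 / p. 268: Lemma 1 of [6] with `α₁ = 0` ("the averages agree",
the `δ((U′U₁)‾(Ū₁)⁻¹)` of (13) / `δ(V̄_k V⁻¹)`–constraints of (49)) and `α₀ = cL²B₃ε` (`c = 2`: p. 259 with
`ε = g₀p(g₀)`; `c = 4`: p. 268 with `ε = g_kp(g_k)`), i.e. plaquette bounds `cB₃ε = α₀L⁻²` for BOTH fields of the pair
((1.7)_{k=1} of [6] for `V₀ = U₁` and `V′V₀ = U′U₁`; resp. `V^{(k)}` and `V_k`) and agreement of the axial trees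
((1.24) of [6], `(R(V₀)V′)(Γ_{y,x}) = 1` ⟺ `(V′V₀)(Γ_{y,x}) = V₀(Γ_{y,x})`, the content of `δ_{Ax}`), gives
`|V′_b − 1| < 4d²α₀ + 0 = 4cd²L²B₃ε` on every bond of the block pair (`lemma1_alpha1_zero`): `8d²L²B₃ε` (`claim259`),
`16d²L²B₃ε` (`claim268`); at `d = 3` the printed `8·3²`, `16·3²` (`claim259_d3`, `claim268_d3`).  PROVED (kernel; axioms
`propext`, `Classical.choice`, `Quot.sound`); no definitions, no new facts.

MODEL / DECLARED DEVIATIONS (referee columns F6/F7; those of `B7Prop1Local`, `B14.Claim246` (D1)–(D3) and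
`B8Lemma1NonAbelian` are inherited).  (M1) LATTICE: the unit lattice `T₁ ≅ T_ε` of [Balaban1985UV3] (resp. `T^{(k)}`)
is read on `ℤ^d` (no torus; `B7Prop1Explicit` conventions: blocks `B(y) = y + [0, L)^d`, `y ∈ Lℤ^d` not required,
plaquette `(x; κ, μ)`, `V(∂p) = hol V x (plaqWord κ μ)`, block average `bavg`, coarse plaquette `cplaq`, block axial
trees `axialFn`).  (M2) p. 259 / p. 268 are proved BLOCK PAIR BY BLOCK PAIR (`B(y) ∪ B(y + Le_κ)`, the locality of
Lemma 1 of [6]: "depends on (1.7), (1.24) on B(c₋) ∪ B(c₊)"), for every bond `b` with both ends in the pair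
(`B8Lemma1NonAbelian.InPair`); "on Ω₁" = union over the pairs inside `Ω₁`.  (M3) HYPOTHESES AS PRINTED INPUTS: the
regularity of `U₁` (Theorem 1 of [7]) and of `U = U′U₁` (the region of integration, `|U(∂p) − 1| < g₀p(g₀) ≤
2B₃g₀p(g₀)` needs `1 ≤ 2B₃` — print takes it for granted; here both plaquette bounds are hypotheses with the common
constant `cB₃ε`), the axial gauge of `U′` relative to `U₁` and the equality of the averages are hypotheses (`≤`
plaquette bounds where print has `<`: weaker hypotheses, same conclusion).  (M4) SMALLNESS "for g₀ sufficiently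
small": explicitly `cL²B₃ε ≤ 1/(6(d+1))` (Lemma 1's threshold in `lemma1_printedBound`); p. 258: `L²ε₀ ≤ c(d) =
1/(28928(d+1)²(d+4)²)` (r11's constant).  (M5) GAUGE GROUP: `{|u| ≤ 1, |u⁻¹| ≤ 1}`-valued (`U1 𝔸`, ⊇ `U(N)`, `SU(N)`
with the operator norm) — Lemma 1 and Prop. 1 need no more.  (M6) `d ≥ 1` arbitrary (print `d = 3`), `L ≥ 1`.
-/

open scoped BigOperators
open NormedSpace Finset

namespace Literature.MathematicalPhysics.QuantumFieldTheory.Balaban1983to89.B10Eq13RegularityClaims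

open B7Prop1Explicit B7Prop1Local MatrixLog B8Lemma1NonAbelian

-- `Site` alone could resolve to the torus sites of `Setup.lean` through a parent namespace; re-export the `ℤ^d`
-- sites `Fin d → ℤ` of `B7Prop1Explicit` (the convention of `B8Lemma1NonAbelian`, `B14.Claim246`).
export B7Prop1Explicit (Site)

variable {d : ℕ}

/-! ## §1 p. 258: "by Proposition 1 from [4] … |V(∂p′) − 1| < 2L²g₀p(g₀)" -/

section P258

variable (d) (𝔸 : Type*) [NormedRing 𝔸] [NormOneClass 𝔸] [NormedAlgebra ℂ 𝔸] [CompleteSpace 𝔸]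

/-- **p. 258 (verbatim): *"If a configuration U belongs to this region, then it satisfies the regularity conditions
|U(∂p) − 1| < g₀p(g₀) on the domain Ω₀, and by Proposition 1 from [4] the configuration V = Ū satisfies the
conditions |V(∂p′) − 1| < 2L²g₀p(g₀) on Ω₀^{(1)}."*** — this is, for the concrete average (42) of [4] on `ℤ^d` and
with `ε₀ = g₀p(g₀)`, word for word the statement `B14.Claim246.Claim246Printed` ([Balaban1988Convergent] p. 246 quotes
the same sentence): there is `c > 0` such that for `L ≥ 1`, `0 < ε₀`, `L²ε₀ ≤ c`, every `{|u| ≤ 1, |u⁻¹| ≤ 1}`-valued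
`U` and every `L`-plaquette `p′` whose box `Δ(p′)` has its unit plaquettes `ε₀`-close to `1`,
`|Ū(∂p′) − 1| < 2L²ε₀`.  Recorded here under the B10 citation; PROVED by r11's `Claim246Printed_holds`
(`c = 1/(28928(d+1)²(d+4)²)`). [cite: Balaban1985UV3, (12) p.258] -/
theorem claim258 : B14.Claim246.Claim246Printed d 𝔸 :=
  B14.Claim246.Claim246Printed_holds d 𝔸

/-- **p. 258, unfolded at one plaquette `p′ = (Lz; μ, ν)` of `Ω₀^{(1)}`:** with the explicit threshold
`L²ε₀ ≤ 1/(28928(d+1)²(d+4)²)` (`ε₀ = g₀p(g₀)`, "g₀ sufficiently small"), the hypothesis `|U(∂p) − 1| ≤ ε₀` on the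
box `Δ(p′) = [z, z + (L−1)𝟙 + Le_μ + Le_ν]` only, and the conclusion `|V(∂p′) − 1| = |Ū(∂p′) − 1| < 2L²ε₀` for the
coarse plaquette variable `cplaq L (bavg L U) z μ ν`. [cite: Balaban1985UV3, (12) p.258] -/
theorem claim258_plaq {L : ℕ} (hL : 1 ≤ L) {ε₀ : ℝ} (hε : 0 < ε₀)
    (hsmall : (L : ℝ) ^ 2 * ε₀ ≤ 1 / (2 * (14464 * ((d : ℝ) + 1) ^ 2 * ((d : ℝ) + 4) ^ 2)))
    (U : Site d → Fin d → 𝔸ˣ) (hU : ∀ x κ, U x κ ∈ U1 𝔸) (z : Site d) {μ ν : Fin d} (hμν : μ ≠ ν)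
    (h44 : ∀ (x : Site d) (κ κ' : Fin d), κ ≠ κ' → PlaqIn z (deltaHi L z μ ν) (x, κ, κ') →
      ‖((hol U x (plaqWord κ κ') : 𝔸ˣ) : 𝔸) - 1‖ ≤ ε₀) :
    ‖((cplaq L (bavg L U) z μ ν : 𝔸ˣ) : 𝔸) - 1‖ < 2 * (L : ℝ) ^ 2 * ε₀ := by
  -- r11's proof of `Claim246Printed_holds` exhibits the witness `c = 1/(2·14464(d+1)²(d+4)²)`; we rerun its
  -- one-step argument (`prop1_local` + the arithmetic `C₀(L²ε₀)² ≤ ½L²ε₀`) at this explicit threshold.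
  set K : ℝ := 14464 * ((d : ℝ) + 1) ^ 2 * ((d : ℝ) + 4) ^ 2 with hK
  have hKpos : 0 < K := by positivity
  have h1 : (1 : ℝ) ≤ L := by exact_mod_cast hL
  set t : ℝ := (L : ℝ) ^ 2 * ε₀ with ht
  have htpos : 0 < t := by positivity
  have hKt : K * t ≤ 1 / 2 := by
    have := mul_le_mul_of_nonneg_left hsmall hKpos.le
    rwa [show K * (1 / (2 * K)) = 1 / 2 by field_simp] at this
  have hsmall' : 512 * (d + 1) * (d + 4) * (L : ℝ) ^ 2 * ε₀ ≤ 1 := by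
    have hd0 : (0 : ℝ) ≤ d := Nat.cast_nonneg d
    have hle : (512 : ℝ) * ((d : ℝ) + 1) * ((d : ℝ) + 4) ≤ K := by
      rw [hK]; nlinarith [sq_nonneg ((d : ℝ) + 1), sq_nonneg ((d : ℝ) + 4), mul_nonneg hd0 hd0]
    calc (512 : ℝ) * (d + 1) * (d + 4) * (L : ℝ) ^ 2 * ε₀ = (512 * ((d : ℝ) + 1) * ((d : ℝ) + 4)) * t := by
          rw [ht]; ring
      _ ≤ K * t := mul_le_mul_of_nonneg_right hle htpos.le
      _ ≤ 1 := by linarith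
  have hP := prop1_local L hL z hμν U hU hε.le hsmall' h44
  have hq : 226 * (8 * ((d : ℝ) + 1) * ((d : ℝ) + 4) * (L : ℝ) ^ 2 * ε₀) ^ 2 = K * t * t := by
    rw [hK, ht]; ring
  have hlt : (L : ℝ) ^ 2 * ε₀ + 226 * (8 * ((d : ℝ) + 1) * ((d : ℝ) + 4) * (L : ℝ) ^ 2 * ε₀) ^ 2
      < 2 * (L : ℝ) ^ 2 * ε₀ := by
    rw [hq, ← ht]
    have : K * t * t ≤ 1 / 2 * t := mul_le_mul_of_nonneg_right hKt htpos.le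
    nlinarith
  exact lt_of_le_of_lt hP hlt

end P258

/-! ## §2 Lemma 1 of [6] with `α₁ = 0` and `α₀ = cL²B₃ε` on a block pair — the mechanism of p. 259 and p. 268 -/

section Lemma1

variable {𝔸 : Type*} [NormedRing 𝔸] [NormOneClass 𝔸] [NormedAlgebra ℂ 𝔸] [CompleteSpace 𝔸]

/-- **Lemma 1 of [6] as used on p. 259 and p. 268: `α₁ = 0`, `α₀ = cL²B₃ε`.**  On the block pair
`B(y) ∪ B(y + Le_κ)` of `ℤ^d`, let `V₀` (the background: `U₁`, resp. `V^{(k)}`) and `U` (the full field: `U′U₁`,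
resp. `V_k`) be `{|u| ≤ 1, |u⁻¹| ≤ 1}`-valued with plaquette variables `cB₃ε`-close to `1` on the pair ((1.7)_{k=1}
of [6] with `α₀L⁻² = cB₃ε`), with equal block axial trees ((1.24): the relative axial gauge `δ_{Ax}`) and EQUAL block
averages (`α₁ = 0`: the `δ`-constraints of (13)/(49)); if `cL²B₃ε ≤ 1/(6(d+1))` ("for g₀ sufficiently small"), then
the fluctuation field `V′ = UV₀⁻¹` has `|V′_b − 1| < 4d²·cL²B₃ε` on every bond `b` of the pair.
[cite: Balaban1985UV3, (13) p.259] -/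
theorem lemma1_alpha1_zero {L : ℕ} (hL : 1 ≤ L) {U V₀ : Site d → Fin d → 𝔸ˣ} {y : Site d} {κ : Fin d}
    {c B₃ ε : ℝ} (hα : 0 < c * (L : ℝ) ^ 2 * B₃ * ε) (hsmall : c * (L : ℝ) ^ 2 * B₃ * ε ≤ 1 / (6 * ((d : ℝ) + 1)))
    (hU : ∀ x μ, U x μ ∈ U1 𝔸) (hV₀ : ∀ x μ, V₀ x μ ∈ U1 𝔸)
    (hPU : B8Lemma1NonAbelian.PlaqSmall U y (y + pairTop L κ) (c * B₃ * ε))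
    (hP0 : B8Lemma1NonAbelian.PlaqSmall V₀ y (y + pairTop L κ) (c * B₃ * ε))
    (hax : ∀ r : Fin d → Fin L, axialFn U y (y + boxVec L r) = axialFn V₀ y (y + boxVec L r))
    (hax₁ : ∀ r : Fin d → Fin L, axialFn U (y + (L : ℤ) • e κ) (y + (L : ℤ) • e κ + boxVec L r)
      = axialFn V₀ (y + (L : ℤ) • e κ) (y + (L : ℤ) • e κ + boxVec L r))
    (havg : bavg L U y κ = bavg L V₀ y κ)
    (x : Site d) (ν : Fin d) (hx : InPair L y κ x) (hxν : InPair L y κ (x + e ν)) :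
    ‖((pert U V₀ x ν : 𝔸ˣ) : 𝔸) - 1‖ < 4 * (d : ℝ) ^ 2 * (c * (L : ℝ) ^ 2 * B₃ * ε) := by
  have h1 : (1 : ℝ) ≤ L := by exact_mod_cast hL
  have hL2 : (0 : ℝ) < (L : ℝ) ^ 2 := by positivity
  -- the plaquette constant `cB₃ε` is `α₀/L²` with `α₀ = cL²B₃ε`
  have hconv : c * B₃ * ε = c * (L : ℝ) ^ 2 * B₃ * ε / (L : ℝ) ^ 2 := by
    field_simp
  have H : Hyp L U V₀ y κ (c * (L : ℝ) ^ 2 * B₃ * ε / (L : ℝ) ^ 2) 0 :=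
    { memU := hU
      memV₀ := hV₀
      plaqU := hconv ▸ hPU
      plaqV₀ := hconv ▸ hP0
      axial := hax
      axial₁ := hax₁
      avg := by rw [havg, sub_self, norm_zero] }
  have hb := lemma1_printedBound hL H hα hsmall le_rfl (by norm_num) x ν hx hxν
  simpa using hb

/-- **p. 259 (verbatim, render p005): *"The configuration U₁ satisfies the regularity conditions
|U₁(∂p) − 1| < 2B₃g₀p(g₀) on Ω₁, hence U₁, U′U₁ satisfy the assumptions of Lemma 1 [6] with α₀ = 2L²B₃g₀p(g₀),
α₁ = 0, and the lemma yields the bound |V′ − 1| < 8·3²L²B₃g₀p(g₀) for g₀ sufficiently small."*** — PROVED on every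
block pair of `ℤ^d`, every `d` (`ε = g₀p(g₀)`; `8·3² = 8d²` at `d = 3`): `lemma1_alpha1_zero` at `c = 2`.  It is this
bound that makes the enlarged region `χ′ = Π χ({|A′(b)| < 16·3²L²B₃g₀p(g₀)})` of (13) contain the support.
[cite: Balaban1985UV3, (13) p.259] -/
theorem claim259 {L : ℕ} (hL : 1 ≤ L) {U U₁ : Site d → Fin d → 𝔸ˣ} {y : Site d} {κ : Fin d} {B₃ ε : ℝ}
    (hα : 0 < 2 * (L : ℝ) ^ 2 * B₃ * ε) (hsmall : 2 * (L : ℝ) ^ 2 * B₃ * ε ≤ 1 / (6 * ((d : ℝ) + 1)))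
    (hU : ∀ x μ, U x μ ∈ U1 𝔸) (hU₁ : ∀ x μ, U₁ x μ ∈ U1 𝔸)
    (hPU : B8Lemma1NonAbelian.PlaqSmall U y (y + pairTop L κ) (2 * B₃ * ε)) (hP1 : B8Lemma1NonAbelian.PlaqSmall U₁ y (y + pairTop L κ) (2 * B₃ * ε))
    (hax : ∀ r : Fin d → Fin L, axialFn U y (y + boxVec L r) = axialFn U₁ y (y + boxVec L r))
    (hax₁ : ∀ r : Fin d → Fin L, axialFn U (y + (L : ℤ) • e κ) (y + (L : ℤ) • e κ + boxVec L r)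
      = axialFn U₁ (y + (L : ℤ) • e κ) (y + (L : ℤ) • e κ + boxVec L r))
    (havg : bavg L U y κ = bavg L U₁ y κ)
    (x : Site d) (ν : Fin d) (hx : InPair L y κ x) (hxν : InPair L y κ (x + e ν)) :
    ‖((pert U U₁ x ν : 𝔸ˣ) : 𝔸) - 1‖ < 8 * (d : ℝ) ^ 2 * (L : ℝ) ^ 2 * B₃ * ε := by
  have h := lemma1_alpha1_zero hL hα hsmall hU hU₁ hPU hP1 hax hax₁ havg x ν hx hxν
  linarith

/-- **p. 259 at `d = 3`, the printed constant `8·3²`:** `|V′ − 1| < 8·3²·L²B₃g₀p(g₀)`. [cite: Balaban1985UV3, (13) p.259] -/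
theorem claim259_d3 {L : ℕ} (hL : 1 ≤ L) {U U₁ : Site 3 → Fin 3 → 𝔸ˣ} {y : Site 3} {κ : Fin 3} {B₃ ε : ℝ}
    (hα : 0 < 2 * (L : ℝ) ^ 2 * B₃ * ε) (hsmall : 2 * (L : ℝ) ^ 2 * B₃ * ε ≤ 1 / 24)
    (hU : ∀ x μ, U x μ ∈ U1 𝔸) (hU₁ : ∀ x μ, U₁ x μ ∈ U1 𝔸)
    (hPU : B8Lemma1NonAbelian.PlaqSmall U y (y + pairTop L κ) (2 * B₃ * ε)) (hP1 : B8Lemma1NonAbelian.PlaqSmall U₁ y (y + pairTop L κ) (2 * B₃ * ε))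
    (hax : ∀ r : Fin 3 → Fin L, axialFn U y (y + boxVec L r) = axialFn U₁ y (y + boxVec L r))
    (hax₁ : ∀ r : Fin 3 → Fin L, axialFn U (y + (L : ℤ) • e κ) (y + (L : ℤ) • e κ + boxVec L r)
      = axialFn U₁ (y + (L : ℤ) • e κ) (y + (L : ℤ) • e κ + boxVec L r))
    (havg : bavg L U y κ = bavg L U₁ y κ)
    (x : Site 3) (ν : Fin 3) (hx : InPair L y κ x) (hxν : InPair L y κ (x + e ν)) :
    ‖((pert U U₁ x ν : 𝔸ˣ) : 𝔸) - 1‖ < 8 * 3 ^ 2 * (L : ℝ) ^ 2 * B₃ * ε := by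
  have h := claim259 (d := 3) hL hα (by norm_num; linarith) hU hU₁ hPU hP1 hax hax₁ havg x ν hx hxν
  norm_num at h ⊢
  linarith

/-- **p. 268 (verbatim): *"We introduce the gauge fixing terms δ_{Ax(B(Λ_{k+1}))}(V_k) using (9), and we make the
translation V_k = V′_kV^{(k)}. The restrictions on V_k and V^{(k)} imply that the configuration V′_k − 1 is small,
more exactly |V′_k − 1| < 16·3²L²B₃g_kp(g_k)."*** — Lemma 1 of [6] again with `α₁ = 0` (the `δ`-constraints of
(49): `V̄^{(k)} = V = V̄_k` on `Λ_{k+1}`), the restrictions being plaquette bounds `4B₃ε` for both `V_k` and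
`V^{(k)}` (`ε = g_kp(g_k)`, `α₀ = 4L²B₃ε`; `16·3² = 16d²` at `d = 3`): `lemma1_alpha1_zero` at `c = 4`, on every block
pair inside `B(Λ_{k+1})`. [cite: Balaban1985UV3, (49) p.268] -/
theorem claim268 {L : ℕ} (hL : 1 ≤ L) {Vk Vkk : Site d → Fin d → 𝔸ˣ} {y : Site d} {κ : Fin d} {B₃ ε : ℝ}
    (hα : 0 < 4 * (L : ℝ) ^ 2 * B₃ * ε) (hsmall : 4 * (L : ℝ) ^ 2 * B₃ * ε ≤ 1 / (6 * ((d : ℝ) + 1)))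
    (hVk : ∀ x μ, Vk x μ ∈ U1 𝔸) (hVkk : ∀ x μ, Vkk x μ ∈ U1 𝔸)
    (hPk : B8Lemma1NonAbelian.PlaqSmall Vk y (y + pairTop L κ) (4 * B₃ * ε)) (hPkk : B8Lemma1NonAbelian.PlaqSmall Vkk y (y + pairTop L κ) (4 * B₃ * ε))
    (hax : ∀ r : Fin d → Fin L, axialFn Vk y (y + boxVec L r) = axialFn Vkk y (y + boxVec L r))
    (hax₁ : ∀ r : Fin d → Fin L, axialFn Vk (y + (L : ℤ) • e κ) (y + (L : ℤ) • e κ + boxVec L r)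
      = axialFn Vkk (y + (L : ℤ) • e κ) (y + (L : ℤ) • e κ + boxVec L r))
    (havg : bavg L Vk y κ = bavg L Vkk y κ)
    (x : Site d) (ν : Fin d) (hx : InPair L y κ x) (hxν : InPair L y κ (x + e ν)) :
    ‖((pert Vk Vkk x ν : 𝔸ˣ) : 𝔸) - 1‖ < 16 * (d : ℝ) ^ 2 * (L : ℝ) ^ 2 * B₃ * ε := by
  have h := lemma1_alpha1_zero hL hα hsmall hVk hVkk hPk hPkk hax hax₁ havg x ν hx hxν
  linarith

/-- **p. 268 at `d = 3`, the printed constant `16·3²`:** `|V′_k − 1| < 16·3²·L²B₃g_kp(g_k)`. [cite: Balaban1985UV3, (49) p.268] -/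
theorem claim268_d3 {L : ℕ} (hL : 1 ≤ L) {Vk Vkk : Site 3 → Fin 3 → 𝔸ˣ} {y : Site 3} {κ : Fin 3} {B₃ ε : ℝ}
    (hα : 0 < 4 * (L : ℝ) ^ 2 * B₃ * ε) (hsmall : 4 * (L : ℝ) ^ 2 * B₃ * ε ≤ 1 / 24)
    (hVk : ∀ x μ, Vk x μ ∈ U1 𝔸) (hVkk : ∀ x μ, Vkk x μ ∈ U1 𝔸)
    (hPk : B8Lemma1NonAbelian.PlaqSmall Vk y (y + pairTop L κ) (4 * B₃ * ε)) (hPkk : B8Lemma1NonAbelian.PlaqSmall Vkk y (y + pairTop L κ) (4 * B₃ * ε))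
    (hax : ∀ r : Fin 3 → Fin L, axialFn Vk y (y + boxVec L r) = axialFn Vkk y (y + boxVec L r))
    (hax₁ : ∀ r : Fin 3 → Fin L, axialFn Vk (y + (L : ℤ) • e κ) (y + (L : ℤ) • e κ + boxVec L r)
      = axialFn Vkk (y + (L : ℤ) • e κ) (y + (L : ℤ) • e κ + boxVec L r))
    (havg : bavg L Vk y κ = bavg L Vkk y κ)
    (x : Site 3) (ν : Fin 3) (hx : InPair L y κ x) (hxν : InPair L y κ (x + e ν)) :
    ‖((pert Vk Vkk x ν : 𝔸ˣ) : 𝔸) - 1‖ < 16 * 3 ^ 2 * (L : ℝ) ^ 2 * B₃ * ε := by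
  have h := claim268 (d := 3) hL hα (by norm_num; linarith) hVk hVkk hPk hPkk hax hax₁ havg x ν hx hxν
  norm_num at h ⊢
  linarith

end Lemma1

/-! ## §3 The paper's gauge group: unitary configurations (`SU(2)`/`U(N)` ⊂ `M_N(ℂ)`, operator norm) -/

section Unitary

variable {𝔸 : Type*} [CStarAlgebra 𝔸] [Nontrivial 𝔸]

/-- **p. 259 for unitary-valued `U₁`, `U′`** (`G ⊂ U(N)`; the unitary group of a non-trivial C⋆-algebra): the
membership in `{|u| ≤ 1, |u⁻¹| ≤ 1}` is automatic, and the conclusion reads directly on `U′ = V′`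
(`B8Lemma1NonAbelian.lemma1_unitary` at `α₁ = 0`, `α₀ = 2L²B₃ε`): `|U′_b − 1| < 8d²L²B₃ε`.
[cite: Balaban1985UV3, (13) p.259] -/
theorem claim259_unitary {L : ℕ} (hL : 1 ≤ L) {U₁ U' : Site d → Fin d → 𝔸ˣ}
    (hU₁ : ∀ x μ, U₁ x μ ∈ B7Prop2Explicit.unitaryUnits 𝔸) (hU' : ∀ x μ, U' x μ ∈ B7Prop2Explicit.unitaryUnits 𝔸)
    {y : Site d} {κ : Fin d} {B₃ ε : ℝ}
    (hα : 0 < 2 * (L : ℝ) ^ 2 * B₃ * ε) (hsmall : 2 * (L : ℝ) ^ 2 * B₃ * ε ≤ 1 / (6 * ((d : ℝ) + 1)))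
    (hP1 : B8Lemma1NonAbelian.PlaqSmall U₁ y (y + pairTop L κ) (2 * B₃ * ε))
    (hPU : B8Lemma1NonAbelian.PlaqSmall (mulCfg U' U₁) y (y + pairTop L κ) (2 * B₃ * ε))
    (hax : ∀ r : Fin d → Fin L, axialFn (mulCfg U' U₁) y (y + boxVec L r) = axialFn U₁ y (y + boxVec L r))
    (hax₁ : ∀ r : Fin d → Fin L, axialFn (mulCfg U' U₁) (y + (L : ℤ) • e κ) (y + (L : ℤ) • e κ + boxVec L r)
      = axialFn U₁ (y + (L : ℤ) • e κ) (y + (L : ℤ) • e κ + boxVec L r))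
    (havg : bavg L (mulCfg U' U₁) y κ = bavg L U₁ y κ)
    (x : Site d) (ν : Fin d) (hx : InPair L y κ x) (hxν : InPair L y κ (x + e ν)) :
    ‖((U' x ν : 𝔸ˣ) : 𝔸) - 1‖ < 8 * (d : ℝ) ^ 2 * (L : ℝ) ^ 2 * B₃ * ε := by
  have h1 : (1 : ℝ) ≤ L := by exact_mod_cast hL
  have hL2 : (0 : ℝ) < (L : ℝ) ^ 2 := by positivity
  have hconv : 2 * B₃ * ε = 2 * (L : ℝ) ^ 2 * B₃ * ε / (L : ℝ) ^ 2 := by field_simp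
  have havg' : ‖(bavg L (mulCfg U' U₁) y κ : 𝔸) - bavg L U₁ y κ‖ ≤ 0 := by
    rw [havg, sub_self, norm_zero]
  have h := lemma1_unitary hL hU₁ hU' (hconv ▸ hP1) (hconv ▸ hPU) hax hax₁ havg' hα hsmall le_rfl
    (by norm_num) x ν hx hxν
  linarith

end Unitary

-- Axiom audit (scratch, not shipped): `#print axioms` of `claim258_plaq`, `claim259_d3`, `claim268`,
-- `claim259_unitary` = [propext, Classical.choice, Quot.sound].

end Literature.MathematicalPhysics.QuantumFieldTheory.Balaban1983to89.B10Eq13RegularityClaims
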